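import Summits.Ventures.HodgeRepro2.T5SU11ResolventMonotoneDecay
import Summits.Ventures.HodgeRepro2.T5SU11ResolventBoundary
import Summits.Ventures.HodgeRepro2.T5SU11SphericalGrowth
import Summits.Ventures.HodgeRepro2.T5SU11SphericalLegendreHigher
import Summits.Ventures.HodgeRepro2.T5SU11ImproperDerivativeBoundsAll

/-!
# The resolvent of the constant source: `G^I_λ 1 = −1/μ`, and the `L^∞` bound `‖G^I_λ g‖_∞ ≤ ‖g‖_∞/μ` (`λ > 2`)

For `λ > 2` (so `μ = λ(λ − 2) > 0`) the constant source `1` is in the class of row 499 (rate `0 > 2 − λ`), and its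
improper Green's solution is computed in closed form:

* `B^I(t) = ∫_0^t φ_λ sinh 2s = sinh 2t φ_λ′(t)/μ` (`greenBI_one_eq`, row 450's Lagrange identity);
* `A^I(t) = ∫_t^∞ χ_λ sinh 2s = −sinh 2t χ_λ′(t)/μ` (`greenAI_one_eq`): `(sinh 2s χ_λ′)′ = μ sinh 2s χ_λ`
  (`hasDerivAt_sinh_mul_sphDecay'`) and `sinh 2R χ_λ′(R) → 0` (`tendsto_sinh_mul_sphDecay'_atTop`: `χ_λ′ = φ_λ′ T_λ − 1/(sinh 2t φ_λ)`,
  `|φ_λ′| ≤ C(1 + t) φ_λ`, `φ_λ ≤ e^{(λ−2)t}`, `T_λ ≤ 2K e^{−2(λ−1)t}`, `φ_λ ≥ (c/2) e^{(λ−2)t}`);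
* hence, by the Wronskian `sinh 2t (φ_λ χ_λ′ − φ_λ′ χ_λ) = −1`, **`G^I_λ 1 ≡ −1/μ` on `(0, ∞)`** (`greenSolI_one_eq`) —
  the resolvent of the constant is the constant `−1/μ`, as `(L − μ)(−1/μ) = 1`;
* consequently **`|G^I_λ g(t)| ≤ sup |g| / μ` for every bounded continuous source** (`abs_greenSolI_le_div`): the kernel
  of `G^I_λ` is of one sign with row sums `∫ |K_λ(t, s)| sinh 2s ds = −G^I_λ 1(t) = 1/μ` — the sharp `L^∞` bound of the
  resolvent, `1/μ = 1/dist(μ, 0)`.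

Nothing is claimed about (N).

Blind lane: Mathlib + the HodgeRepro2 prefix only; no sorry; axioms ⊆ {propext, Classical.choice,
Quot.sound}.
-/

namespace Summit.Ventures.HodgeRepro2.T5SU11ResolventConstantSource

open Filter Topology MeasureTheory intervalIntegral
open Set (Ioi Ioc Icc uIcc)
open T5SU11Cartan T5SU11SphericalFunction T5SU11SphericalBounds T5SU11SphericalContinuous T5SU11SphericalAsymptotic
  T5SU11SphericalCfun T5SU11SphericalGrowth T5SU11SphericalSolutionSpaceAll T5SU11SphericalDecay
  T5SU11SphericalDecayBracket T5SU11SphericalLegendreHigher T5SU11ReductionOfOrder T5SU11ReductionOfOrderInfinity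
  T5SU11ResolventBoundary T5SU11RadialGreen T5SU11RadialGreenImproper T5SU11RadialGreenImproperDecaySource
  T5SU11ResolventMonotoneDecay T5SU11ImproperDerivativeBoundsAll

section measure

variable [MeasurableSpace Circle] [BorelSpace Circle]

variable {lam : ℝ} (hlam : 1 < lam)

include hlam in
/-- **`(sinh 2t χ_λ′)′ = μ sinh 2t χ_λ`** on `(0, ∞)`. -/
theorem hasDerivAt_sinh_mul_sphDecay' {t : ℝ} (ht : 0 < t) :
    HasDerivAt (fun s => Real.sinh (2 * s) * sphDecay' lam s) (lam * (lam - 2) * Real.sinh (2 * t) * sphDecay lam t) t := by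
  have h := (hasDerivAt_sinh_two_mul_self t).mul (hasDerivAt_sphDecay' lam ht)
  refine h.congr_deriv ?_
  have hode := sphDecay_ode hlam ht
  linarith

/-- The constant source `1` is integrable against `φ_λ sinh 2s` on every `(0, t]`. -/
theorem integrableOn_sph_mul_one_mul_sinh (lam t : ℝ) :
    IntegrableOn (fun s => sph lam (hyp s) * (1 : ℝ) * Real.sinh (2 * s)) (Ioc 0 t) :=
  integrableOn_sph_mul_mul_sinh_Ioc (g := fun _ => (1 : ℝ)) continuousOn_const (M := 1)
    (fun _ _ => by simp) zero_le_one lam t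

/-- The constant source `1` is integrable against `χ_λ sinh 2s` on `(0, ∞)` for `λ > 2`. -/
theorem integrableOn_sphDecay_mul_one_mul_sinh (h2 : 2 < lam) :
    IntegrableOn (fun s => sphDecay lam s * (1 : ℝ) * Real.sinh (2 * s)) (Ioi 0) :=
  integrableOn_sphDecay_mul_mul_sinh (by linarith) (g := fun _ => (1 : ℝ)) continuousOn_const (M := 1)
    (fun _ _ => by simp) zero_le_one (ε := 0) (C := 1) (s₀ := 0) (by linarith) (fun s _ => by simp)

/-- **`B^I(t) = sinh 2t φ_λ′(t)/μ`** for the constant source (`μ ≠ 0`). -/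
theorem greenBI_one_eq (hμ : lam * (lam - 2) ≠ 0) {t : ℝ} (ht : 0 < t) :
    greenBI (fun t => sph lam (hyp t)) (fun _ => (1 : ℝ)) t
      = Real.sinh (2 * t) * deriv (fun t => sph lam (hyp t)) t / (lam * (lam - 2)) := by
  unfold greenBI
  rw [← integral_of_le ht.le]
  have h := sinh_mul_deriv_sph_hyp_eq lam t
  have e : ∫ s in (0 : ℝ)..t, sph lam (hyp s) * (1 : ℝ) * Real.sinh (2 * s)
      = ∫ s in (0 : ℝ)..t, Real.sinh (2 * s) * sph lam (hyp s) := integral_congr (fun s _ => by ring)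
  rw [e, eq_div_iff hμ]
  linarith

/-! ### `sinh 2R χ_λ′(R) → 0` for `λ > 2` -/

omit [MeasurableSpace Circle] [BorelSpace Circle] in
/-- `(1 + R) e^{−aR} ≤ (1 + 2/a) e^{−(a/2) R}` for `a > 0`, `R ≥ 0`. -/
theorem one_add_mul_exp_neg_le {a R : ℝ} (ha : 0 < a) (hR : 0 ≤ R) :
    (1 + R) * Real.exp (-(a * R)) ≤ (1 + 2 / a) * Real.exp (-(a / 2 * R)) := by
  have h1 : 1 + a / 2 * R ≤ Real.exp (a / 2 * R) := by
    have := Real.add_one_le_exp (a / 2 * R); linarith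
  have h2 : (1 + R) ≤ (1 + 2 / a) * (1 + a / 2 * R) := by
    have e : (1 + 2 / a) * (1 + a / 2 * R) = 1 + R + 2 / a + a / 2 * R := by field_simp; ring
    rw [e]
    have : 0 ≤ a / 2 * R := by positivity
    have : 0 ≤ 2 / a := by positivity
    linarith
  have hE : 0 < Real.exp (-(a * R)) := Real.exp_pos _
  have e2 : Real.exp (-(a * R)) = Real.exp (-(a / 2 * R)) * Real.exp (-(a / 2 * R)) := by
    rw [← Real.exp_add]; congr 1; ring
  have hE2 : 0 < Real.exp (-(a / 2 * R)) := Real.exp_pos _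
  have h3 : Real.exp (-(a / 2 * R)) * (1 + a / 2 * R) ≤ 1 := by
    rw [Real.exp_neg]
    have hpos : 0 < Real.exp (a / 2 * R) := Real.exp_pos _
    rw [inv_mul_le_iff₀ hpos, mul_one]
    exact h1
  calc (1 + R) * Real.exp (-(a * R))
      ≤ (1 + 2 / a) * (1 + a / 2 * R) * Real.exp (-(a * R)) := mul_le_mul_of_nonneg_right h2 hE.le
    _ = (1 + 2 / a) * Real.exp (-(a / 2 * R)) * (Real.exp (-(a / 2 * R)) * (1 + a / 2 * R)) := by rw [e2]; ring
    _ ≤ (1 + 2 / a) * Real.exp (-(a / 2 * R)) * 1 :=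
        mul_le_mul_of_nonneg_left h3 (by positivity)
    _ = (1 + 2 / a) * Real.exp (-(a / 2 * R)) := mul_one _

include hlam in
/-- **`sinh 2R χ_λ′(R) → 0` as `R → ∞`** for `λ > 2`. -/
theorem tendsto_sinh_mul_sphDecay'_atTop (h2 : 2 < lam) :
    Tendsto (fun R => Real.sinh (2 * R) * sphDecay' lam R) atTop (𝓝 0) := by
  set a := lam - 2 with ha
  have ha0 : 0 < a := by rw [ha]; linarith
  have hc : 0 < cfun (2 - lam) := cfun_pos (by linarith)
  set K := 1 / ((lam - 1) * cfun (2 - lam) ^ 2) with hK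
  have hK0 : 0 < K := by
    have : 0 < lam - 1 := by linarith
    positivity
  obtain ⟨C, hC0, hC⟩ := exists_abs_deriv_sph_hyp_le_mul hlam
  -- the bound `|sinh 2R χ′(R)| ≤ (C K (1 + 2/a) + 2/c) e^{−(a/2) R}` eventually
  have hbound : ∀ᶠ R in atTop, |Real.sinh (2 * R) * sphDecay' lam R|
      ≤ (C * K * (1 + 2 / a) + 2 / cfun (2 - lam)) * Real.exp (-(a / 2 * R)) := by
    filter_upwards [eventually_tailIntegral_le hlam, eventually_le_sph_hyp hlam, eventually_ge_atTop 1] with R hT hφ hR1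
    have hR0 : 0 < R := by linarith
    have hφ0 : 0 < sph lam (hyp R) := sph_hyp_pos lam R
    have hs0 : 0 < Real.sinh (2 * R) := sinh_two_mul_pos hR0
    have hT0 : 0 ≤ tailIntegral (fun t => sph lam (hyp t)) R := tailIntegral_sph_nonneg hlam hR0
    have hE : 0 < Real.exp ((lam - 2) * R) := Real.exp_pos _
    -- `sinh 2R χ′ = sinh 2R φ′ T − 1/φ`
    have e : Real.sinh (2 * R) * sphDecay' lam R
        = Real.sinh (2 * R) * deriv (fun t => sph lam (hyp t)) R * tailIntegral (fun t => sph lam (hyp t)) R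
          - 1 / sph lam (hyp R) := by
      rw [sphDecay'_eq hlam hR0]
      field_simp
    rw [e]
    -- first term
    have h1 : |Real.sinh (2 * R) * deriv (fun t => sph lam (hyp t)) R * tailIntegral (fun t => sph lam (hyp t)) R|
        ≤ C * K * (1 + R) * Real.exp (-(a * R)) := by
      rw [abs_mul, abs_mul, abs_of_pos hs0, abs_of_nonneg hT0]
      have hφle : sph lam (hyp R) ≤ Real.exp ((lam - 2) * R) := sph_hyp_le_exp_of_two_le h2.le hR0.le
      have hsinh : Real.sinh (2 * R) ≤ Real.exp (2 * R) / 2 := sinh_le_exp_div_two (2 * R)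
      have hφ' : |deriv (fun t => sph lam (hyp t)) R| ≤ C * (1 + R) * Real.exp ((lam - 2) * R) :=
        le_trans (hC R hR0.le) (mul_le_mul_of_nonneg_left hφle (by positivity))
      calc Real.sinh (2 * R) * |deriv (fun t => sph lam (hyp t)) R| * tailIntegral (fun t => sph lam (hyp t)) R
          ≤ (Real.exp (2 * R) / 2) * (C * (1 + R) * Real.exp ((lam - 2) * R))
              * (2 * K * Real.exp (-(2 * (lam - 1)) * R)) := by
            apply mul_le_mul (mul_le_mul hsinh hφ' (abs_nonneg _) (by positivity)) hT hT0 (by positivity)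
        _ = C * K * (1 + R) * (Real.exp (2 * R) * Real.exp ((lam - 2) * R) * Real.exp (-(2 * (lam - 1)) * R)) := by
            ring
        _ = C * K * (1 + R) * Real.exp (-(a * R)) := by
            rw [← Real.exp_add, ← Real.exp_add]; congr 2; rw [ha]; ring
    -- second term
    have h2' : |1 / sph lam (hyp R)| ≤ 2 / cfun (2 - lam) * Real.exp (-(a * R)) := by
      rw [abs_of_pos (by positivity), div_le_iff₀ hφ0]
      have hlow : cfun (2 - lam) / 2 * Real.exp (a * R) ≤ sph lam (hyp R) := by rw [ha]; exact hφ
      have hee : Real.exp (-(a * R)) * Real.exp (a * R) = 1 := by rw [← Real.exp_add]; simp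
      have hcc : 2 / cfun (2 - lam) * (cfun (2 - lam) / 2) = 1 := by field_simp
      calc (1 : ℝ) = (2 / cfun (2 - lam) * (cfun (2 - lam) / 2)) * (Real.exp (-(a * R)) * Real.exp (a * R)) := by
            rw [hcc, hee, one_mul]
        _ = 2 / cfun (2 - lam) * Real.exp (-(a * R)) * (cfun (2 - lam) / 2 * Real.exp (a * R)) := by ring
        _ ≤ 2 / cfun (2 - lam) * Real.exp (-(a * R)) * sph lam (hyp R) :=
            mul_le_mul_of_nonneg_left hlow (by positivity)
    have hpoly := one_add_mul_exp_neg_le ha0 hR0.le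
    have hE2 : 0 < Real.exp (-(a / 2 * R)) := Real.exp_pos _
    have hEle : Real.exp (-(a * R)) ≤ Real.exp (-(a / 2 * R)) := by
      apply Real.exp_le_exp.mpr; nlinarith
    calc |Real.sinh (2 * R) * deriv (fun t => sph lam (hyp t)) R * tailIntegral (fun t => sph lam (hyp t)) R
          - 1 / sph lam (hyp R)|
        ≤ |Real.sinh (2 * R) * deriv (fun t => sph lam (hyp t)) R * tailIntegral (fun t => sph lam (hyp t)) R|
          + |1 / sph lam (hyp R)| := abs_sub _ _
      _ ≤ C * K * (1 + R) * Real.exp (-(a * R)) + 2 / cfun (2 - lam) * Real.exp (-(a * R)) := add_le_add h1 h2'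
      _ ≤ C * K * ((1 + 2 / a) * Real.exp (-(a / 2 * R))) + 2 / cfun (2 - lam) * Real.exp (-(a / 2 * R)) := by
          apply add_le_add
          · rw [mul_assoc (C * K)]
            exact mul_le_mul_of_nonneg_left hpoly (by positivity)
          · exact mul_le_mul_of_nonneg_left hEle (by positivity)
      _ = (C * K * (1 + 2 / a) + 2 / cfun (2 - lam)) * Real.exp (-(a / 2 * R)) := by ring
  have hlim : Tendsto (fun R => (C * K * (1 + 2 / a) + 2 / cfun (2 - lam)) * Real.exp (-(a / 2 * R))) atTop (𝓝 0) := by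
    have h := (Real.tendsto_exp_neg_atTop_nhds_zero.comp (tendsto_id.const_mul_atTop (by positivity : 0 < a / 2))).const_mul
      (C * K * (1 + 2 / a) + 2 / cfun (2 - lam))
    rw [mul_zero] at h
    exact h
  exact squeeze_zero_norm' hbound hlim

include hlam in
/-- **`A^I(t) = −sinh 2t χ_λ′(t)/μ`** for the constant source, `λ > 2`. -/
theorem greenAI_one_eq (h2 : 2 < lam) {t : ℝ} (ht : 0 < t) :
    greenAI (sphDecay lam) (fun _ => (1 : ℝ)) t = -(Real.sinh (2 * t) * sphDecay' lam t) / (lam * (lam - 2)) := by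
  have hμ : 0 < lam * (lam - 2) := mul_pos (by linarith) (by linarith)
  set F : ℝ → ℝ := fun s => Real.sinh (2 * s) * sphDecay' lam s with hF
  have hI := integrableOn_sphDecay_mul_one_mul_sinh (lam := lam) h2
  have hlimI : Tendsto (fun R => ∫ s in t..R, sphDecay lam s * (1 : ℝ) * Real.sinh (2 * s)) atTop
      (𝓝 (∫ s in Ioi t, sphDecay lam s * (1 : ℝ) * Real.sinh (2 * s))) :=
    intervalIntegral_tendsto_integral_Ioi t (hI.mono_set (Set.Ioi_subset_Ioi ht.le)) tendsto_id
  have hlimF : Tendsto (fun R => (F R - F t) / (lam * (lam - 2))) atTop (𝓝 ((0 - F t) / (lam * (lam - 2)))) :=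
    ((tendsto_sinh_mul_sphDecay'_atTop hlam h2).sub tendsto_const_nhds).div_const _
  have heq : ∀ᶠ R in atTop, (F R - F t) / (lam * (lam - 2)) = ∫ s in t..R, sphDecay lam s * (1 : ℝ) * Real.sinh (2 * s) := by
    filter_upwards [eventually_ge_atTop t] with R hR
    have hsub : uIcc t R ⊆ Ioi 0 := uIcc_subset_Ioi ht (lt_of_lt_of_le ht hR)
    have hint : IntervalIntegrable (fun s => lam * (lam - 2) * Real.sinh (2 * s) * sphDecay lam s) volume t R := by
      have : IntervalIntegrable (fun s => sphDecay lam s * (1 : ℝ) * Real.sinh (2 * s)) volume t R :=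
        (intervalIntegrable_iff_integrableOn_Ioc_of_le hR).mpr (hI.mono_set (fun s hs => lt_of_le_of_lt ht.le hs.1))
      refine (this.const_mul (lam * (lam - 2))).congr (fun s _ => ?_)
      ring
    have hftc := integral_eq_sub_of_hasDerivAt (f := F)
      (fun s hs => hasDerivAt_sinh_mul_sphDecay' hlam (hsub hs)) hint
    have e : ∫ s in t..R, lam * (lam - 2) * Real.sinh (2 * s) * sphDecay lam s
        = lam * (lam - 2) * ∫ s in t..R, sphDecay lam s * (1 : ℝ) * Real.sinh (2 * s) := by
      rw [← intervalIntegral.integral_const_mul]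
      exact integral_congr (fun s _ => by ring)
    rw [e] at hftc
    rw [← hftc, mul_div_cancel_left₀ _ hμ.ne']
  unfold greenAI
  have := tendsto_nhds_unique hlimI (hlimF.congr' heq)
  rw [this, zero_sub]

include hlam in
/-- **THE RESOLVENT OF THE CONSTANT SOURCE**: `G^I_λ 1 ≡ −1/μ` on `(0, ∞)` for `λ > 2` (`μ = λ(λ − 2) > 0`). -/
theorem greenSolI_one_eq (h2 : 2 < lam) {t : ℝ} (ht : 0 < t) :
    greenSolI (fun t => sph lam (hyp t)) (sphDecay lam) (fun _ => (1 : ℝ)) t = -1 / (lam * (lam - 2)) := by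
  have hμ : lam * (lam - 2) ≠ 0 := (mul_pos (by linarith) (by linarith)).ne'
  unfold greenSolI
  rw [greenBI_one_eq hμ ht, greenAI_one_eq hlam h2 ht]
  have hW := wronskian_sphDecay hlam ht
  have e : -(sphDecay lam t * (Real.sinh (2 * t) * deriv (fun t => sph lam (hyp t)) t / (lam * (lam - 2))))
      - sph lam (hyp t) * (-(Real.sinh (2 * t) * sphDecay' lam t) / (lam * (lam - 2)))
      = (Real.sinh (2 * t) * (sph lam (hyp t) * sphDecay' lam t - deriv (fun t => sph lam (hyp t)) t * sphDecay lam t))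
        / (lam * (lam - 2)) := by
    field_simp
    ring
  rw [e, hW]

/-! ### The `L^∞` bound -/

include hlam in
/-- **THE `L^∞` BOUND OF THE RESOLVENT**: `|G^I_λ g(t)| ≤ K/μ` for every `t > 0` when `g` is continuous on `(0, ∞)` with
`|g| ≤ K` there, `λ > 2`. -/
theorem abs_greenSolI_le_div (h2 : 2 < lam) {g : ℝ → ℝ} (hg : ContinuousOn g (Ioi 0)) {K : ℝ}
    (hK : ∀ s, 0 < s → |g s| ≤ K) {t : ℝ} (ht : 0 < t) :
    |greenSolI (fun t => sph lam (hyp t)) (sphDecay lam) g t| ≤ K / (lam * (lam - 2)) := by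
  have hμ : 0 < lam * (lam - 2) := mul_pos (by linarith) (by linarith)
  have hK0 : 0 ≤ K := le_trans (abs_nonneg _) (hK 1 one_pos)
  have hε : 2 - lam < (0 : ℝ) := by linarith
  have hM : ∀ s ∈ Ioc (0 : ℝ) 1, |g s| ≤ K := fun s hs => hK s hs.1
  have hC : ∀ s, (1 : ℝ) ≤ s → |g s| ≤ K * Real.exp (-(0 : ℝ) * s) := fun s hs => by
    simpa using hK s (by linarith)
  have hB := integrableOn_sph_mul_mul_sinh_Ioc hg hM hK0 lam t
  have hA := (integrableOn_sphDecay_mul_mul_sinh (by linarith) hg hM hK0 hε hC).mono_set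
    (Set.Ioi_subset_Ioi ht.le)
  have hB1 := integrableOn_sph_mul_one_mul_sinh lam t
  have hA1 := (integrableOn_sphDecay_mul_one_mul_sinh (lam := lam) h2).mono_set (Set.Ioi_subset_Ioi ht.le)
  have hχ : 0 < sphDecay lam t := sphDecay_pos hlam ht
  have hφ : 0 < sph lam (hyp t) := sph_hyp_pos lam t
  -- `|B^I(g)| ≤ K B^I(1)`
  have hBle : |greenBI (fun t => sph lam (hyp t)) g t| ≤ K * greenBI (fun t => sph lam (hyp t)) (fun _ => (1 : ℝ)) t := by
    unfold greenBI
    calc |∫ s in Ioc 0 t, sph lam (hyp s) * g s * Real.sinh (2 * s)|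
        ≤ ∫ s in Ioc 0 t, |sph lam (hyp s) * g s * Real.sinh (2 * s)| := by
          have := norm_integral_le_integral_norm (μ := volume.restrict (Ioc 0 t))
            (fun s => sph lam (hyp s) * g s * Real.sinh (2 * s))
          simpa only [Real.norm_eq_abs] using this
      _ ≤ ∫ s in Ioc 0 t, K * (sph lam (hyp s) * (1 : ℝ) * Real.sinh (2 * s)) := by
          apply setIntegral_mono_on hB.abs (hB1.const_mul K) measurableSet_Ioc
          intro s hs
          have hs0 : 0 < s := hs.1
          have hsinh : 0 ≤ Real.sinh (2 * s) := Real.sinh_nonneg_iff.mpr (by linarith)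
          rw [abs_mul, abs_mul, abs_of_pos (sph_hyp_pos lam s), abs_of_nonneg hsinh, mul_one]
          have := hK s hs0
          have hφs : 0 < sph lam (hyp s) := sph_hyp_pos lam s
          calc sph lam (hyp s) * |g s| * Real.sinh (2 * s) ≤ sph lam (hyp s) * K * Real.sinh (2 * s) := by
                apply mul_le_mul_of_nonneg_right _ hsinh
                exact mul_le_mul_of_nonneg_left this hφs.le
            _ = K * (sph lam (hyp s) * Real.sinh (2 * s)) := by ring
      _ = K * ∫ s in Ioc 0 t, sph lam (hyp s) * (1 : ℝ) * Real.sinh (2 * s) := MeasureTheory.integral_const_mul _ _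
  -- `|A^I(g)| ≤ K A^I(1)`
  have hAle : |greenAI (sphDecay lam) g t| ≤ K * greenAI (sphDecay lam) (fun _ => (1 : ℝ)) t := by
    unfold greenAI
    calc |∫ s in Ioi t, sphDecay lam s * g s * Real.sinh (2 * s)|
        ≤ ∫ s in Ioi t, |sphDecay lam s * g s * Real.sinh (2 * s)| := by
          have := norm_integral_le_integral_norm (μ := volume.restrict (Ioi t))
            (fun s => sphDecay lam s * g s * Real.sinh (2 * s))
          simpa only [Real.norm_eq_abs] using this
      _ ≤ ∫ s in Ioi t, K * (sphDecay lam s * (1 : ℝ) * Real.sinh (2 * s)) := by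
          apply setIntegral_mono_on hA.abs (hA1.const_mul K) measurableSet_Ioi
          intro s hs
          have hs0 : 0 < s := lt_trans ht hs
          have hsinh : 0 ≤ Real.sinh (2 * s) := Real.sinh_nonneg_iff.mpr (by linarith)
          have hχs : 0 < sphDecay lam s := sphDecay_pos hlam hs0
          rw [abs_mul, abs_mul, abs_of_pos hχs, abs_of_nonneg hsinh, mul_one]
          have := hK s hs0
          calc sphDecay lam s * |g s| * Real.sinh (2 * s) ≤ sphDecay lam s * K * Real.sinh (2 * s) := by
                apply mul_le_mul_of_nonneg_right _ hsinh
                exact mul_le_mul_of_nonneg_left this hχs.le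
            _ = K * (sphDecay lam s * Real.sinh (2 * s)) := by ring
      _ = K * ∫ s in Ioi t, sphDecay lam s * (1 : ℝ) * Real.sinh (2 * s) := MeasureTheory.integral_const_mul _ _
  -- assemble with `G^I_λ 1 = −1/μ`
  have hG1 := greenSolI_one_eq hlam h2 ht
  unfold greenSolI at hG1 ⊢
  have hsum : sphDecay lam t * greenBI (fun t => sph lam (hyp t)) (fun _ => (1 : ℝ)) t
      + sph lam (hyp t) * greenAI (sphDecay lam) (fun _ => (1 : ℝ)) t = 1 / (lam * (lam - 2)) := by
    have : -1 / (lam * (lam - 2)) = -(1 / (lam * (lam - 2))) := by ring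
    linarith [hG1, this]
  calc |-(sphDecay lam t * greenBI (fun t => sph lam (hyp t)) g t) - sph lam (hyp t) * greenAI (sphDecay lam) g t|
      ≤ sphDecay lam t * |greenBI (fun t => sph lam (hyp t)) g t| + sph lam (hyp t) * |greenAI (sphDecay lam) g t| := by
        have := abs_sub (-(sphDecay lam t * greenBI (fun t => sph lam (hyp t)) g t))
          (sph lam (hyp t) * greenAI (sphDecay lam) g t)
        rwa [abs_neg, abs_mul, abs_mul, abs_of_pos hχ, abs_of_pos hφ] at this
    _ ≤ sphDecay lam t * (K * greenBI (fun t => sph lam (hyp t)) (fun _ => (1 : ℝ)) t)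
        + sph lam (hyp t) * (K * greenAI (sphDecay lam) (fun _ => (1 : ℝ)) t) :=
        add_le_add (mul_le_mul_of_nonneg_left hBle hχ.le) (mul_le_mul_of_nonneg_left hAle hφ.le)
    _ = K * (sphDecay lam t * greenBI (fun t => sph lam (hyp t)) (fun _ => (1 : ℝ)) t
        + sph lam (hyp t) * greenAI (sphDecay lam) (fun _ => (1 : ℝ)) t) := by ring
    _ = K / (lam * (lam - 2)) := by rw [hsum]; ring

end measure

end Summit.Ventures.HodgeRepro2.T5SU11ResolventConstantSource
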